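import Summits.Schanuel.Schanuel.Theorems.ZilberEacDegenerateDirectionPoints
import Summits.Schanuel.Schanuel.Theorems.ZilberEacParamCurveEscape
import Summits.Schanuel.Schanuel.Theorems.ZilberEacFermatBaseFamily
import HarnessLib

/-!
# The exponential-polynomial regime, CXI: ZARISKI DENSITY for surfaces whose fibre relation
# involves BOTH `y₀` AND `y₁`, along an unbounded place in a degenerate direction; THE
# FERMAT–MANTOVA–MASSER EXAMPLE `{x₀ⁿ + x₁ⁿ = 1, y₀ + y₁ = 1}` for every `n ≥ 2`

HONEST FRAMING.  Cell `pub-schanuel` (Zilber's Exponential-Algebraic Closedness, case ladder;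
host summit Schanuel), seat 2, gen 34.  Mantova–Masser (PLMS 2024 §1 p. 5) ask whether the
unprojected exponential points of a surface `W` of their case (dim-π-S-1-free) are Zariski dense in
`W`, and flag the example (fermat): `X₁⁹ + X₂⁹ = 1`, `X̂₁ + X̂₂ = 1`, whose fibre relation involves
BOTH multiplicative coordinates — their "exponential-polynomial" regime, which the cell's
verdicts up to gen 33 (cylinders; curves with a rational asymptote) do not reach over curves
without rational asymptotes.  This file combines the existence theorem of file CX (c) with
THEOREM G (growth, `unprojectedDense_of_growth`):
* **`unprojectedDense_degenerateDirection`** (S-form): `F` irreducible, a place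
  `x₀ = s^{-k}`, `x₁ = Φ(s)s^{-M}` (`M ≥ 1`), a direction `z^k = 2πi` with `Re(Φ(0)z^M) < 0`, a
  relation `G ∈ ℂ[x₀, x₁, y₁][y₀]` with nondegenerate degenerate part `G₀ = G|_{y₁=0}`; every
  irreducible closed `S` of dimension `≤ 2` containing the germ of `{F = 0, G(x, e^{x₁}; y₀) = 0,
  y₁ = e^{x₁}}` along the place has Zariski-dense exponential points;
* **`unprojectedDense_fermat_unitLine`**: for every `n ≥ 2`, every irreducible closed `S` of
  dimension `≤ 2` containing the points `(x₀, x₁, y₀, e^{x₁})` with `x₀ⁿ + x₁ⁿ = 1`,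
  `y₀ + e^{x₁} = 1` has Zariski-dense exponential points — in particular the exponential points of
  Mantova–Masser's surface `{x₀ⁿ + x₁ⁿ = 1, y₀ + y₁ = 1}` (their `n = 9`) are Zariski dense in
  every such `S` containing them (place `x₀ = 1/s`, `x₁ = ζ(1 − sⁿ)^{1/n}/s`, `ζ = e^{iπ/n}`,
  direction `z = 2πi`: `Re(2πiζ) = −2π sin(π/n) < 0`).
Decided instances of an OPEN question; the question in general, EC(3,2), and Zilber's EAC remain
OPEN; NOT Schanuel's conjecture (neither used nor implied); EAC ⇏ SC.
-/

noncomputable section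

open Filter Topology Metric Complex Polynomial
open Literature.NumberTheory.Transcendental Literature.ModelTheory.Zilber
open Literature.ModelTheory.ExponentialFields

set_option linter.dupNamespace false

namespace Summit.Schanuel.Schanuel.Theorems

section DegenerateDirectionDensity

variable (F : ℂ[X][X])

/-! ## Part A. Density in the S-form -/

/-- **DENSITY IN A DEGENERATE DIRECTION (S-form).**  `F` irreducible of positive `x₁`-degree; a
place `x₀ = s^{-k}`, `x₁ = Φ(s)s^{-M}` (`k, M ≥ 1`); a direction `z^k = 2πi` with
`Re(Φ(0)z^M) < 0`; `G ∈ ℂ[x₀, x₁, y₁][y₀]` with degenerate part `G₀` (`F ∤` top, bottom,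
discriminant).  Every irreducible closed `S ⊆ ℂ² × ℂ²` of dimension `≤ 2` which, for all small
`s ≠ 0`, contains every point `(s^{-k}, Φ(s)s^{-M}, y, e^{Φ(s)s^{-M}})` with `y ≠ 0` and
`G(x(s), e^{x₁(s)}; y) = 0`, has Zariski-dense exponential points.
[cite: MantovaMasser2023, §1 Further remarks, p. 5 (the question, open in general)] (new) -/
theorem unprojectedDense_degenerateDirection (hFirr : Irreducible F) (hn : 1 ≤ F.natDegree)
    {k : ℕ} (hk : 1 ≤ k) {M : ℕ} (hM : 1 ≤ M) {Φ : ℂ → ℂ} (hΦan : AnalyticAt ℂ Φ 0)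
    (hplace : ∀ᶠ s in 𝓝[≠] (0 : ℂ),
      (F.map (Polynomial.evalRingHom (s ^ k)⁻¹)).eval (Φ s * (s ^ M)⁻¹) = 0)
    {z : ℂ} (hz : z ^ k = 2 * Real.pi * I) (hdir : (Φ 0 * z ^ M).re < 0)
    (G : Polynomial (MvPolynomial (Fin 3) ℂ)) (G₀ : Polynomial ℂ[X][X])
    (hG₀ : ∀ x₀ x₁ y : ℂ,
      (G₀.map (Polynomial.eval₂RingHom (Polynomial.evalRingHom x₀) x₁)).eval y =
        (G.map (MvPolynomial.eval ![x₀, x₁, 0])).eval y)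
    (hd : 1 ≤ G₀.natDegree) (htop : ¬ F ∣ G₀.leadingCoeff) (hbot : ¬ F ∣ G₀.coeff 0)
    (hdisc : ¬ F ∣ Polynomial.resultant G₀ (derivative G₀) G₀.natDegree (G₀.natDegree - 1))
    {S : Set (Fin 2 ⊕ Fin 2 → ℂ)} (hS : IsIrreducibleClosed ℂ S) (hdim : zariskiDim ℂ S ≤ (2 : ℕ))
    (hsub : ∀ᶠ s in 𝓝[≠] (0 : ℂ), ∀ y : ℂ, y ≠ 0 →
      (G.map (MvPolynomial.eval ![(s ^ k)⁻¹, Φ s * (s ^ M)⁻¹,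
        Complex.exp (Φ s * (s ^ M)⁻¹)])).eval y = 0 →
      (Sum.elim ![(s ^ k)⁻¹, Φ s * (s ^ M)⁻¹] ![y, Complex.exp (Φ s * (s ^ M)⁻¹)] :
        Fin 2 ⊕ Fin 2 → ℂ) ∈ S) :
    UnprojectedDense S := by
  classical
  obtain ⟨p, c, hc, hp0, hp, hF, hre, hnorm, hG⟩ := exists_expPoints_degenerateDirection F hFirr
    hn hk hM hΦan hplace hz hdir G G₀ hG₀ hd htop hbot hdisc
  have hpW : Tendsto p atTop (𝓝[≠] (0 : ℂ)) :=
    tendsto_nhdsWithin_iff.2 ⟨hp, Eventually.of_forall hp0⟩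
  obtain ⟨J₀, hJ₀⟩ := Filter.eventually_atTop.1 (hpW.eventually hsub)
  -- the exponential points
  set P : ℕ → Fin 2 ⊕ Fin 2 → ℂ := fun m =>
    Sum.elim ![(p (J₀ + m) ^ k)⁻¹, Φ (p (J₀ + m)) * (p (J₀ + m) ^ M)⁻¹]
      ![Complex.exp ((p (J₀ + m) ^ k)⁻¹), Complex.exp (Φ (p (J₀ + m)) * (p (J₀ + m) ^ M)⁻¹)]
    with hPdef
  have hPS : ∀ m, P m ∈ S := fun m =>
    hJ₀ (J₀ + m) (Nat.le_add_right _ _) _ (Complex.exp_ne_zero _) (hG (J₀ + m))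
  have hPΓ : ∀ m, P m ∈ expGraph ℂ 2 := by
    intro m
    rw [mem_expGraph_iff]
    intro i
    rw [Literature.ModelTheory.ExponentialFields.ExponentialRing.complex_exp_eq]
    fin_cases i <;> simp [hPdef]
  -- growth of `x₁`
  set Lg : ℕ → ℝ := fun m => c * ‖p (J₀ + m)‖⁻¹ ^ M with hLg
  have hpJ : Tendsto (fun m => p (J₀ + m)) atTop (𝓝 0) :=
    hp.comp ((tendsto_add_atTop_nat J₀).congr fun m => Nat.add_comm m J₀)
  have hLgtop : Tendsto Lg atTop atTop := by
    have h1 : Tendsto (fun m => ‖p (J₀ + m)‖⁻¹) atTop atTop := by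
      have h2 : Tendsto (fun m => ‖p (J₀ + m)‖) atTop (𝓝[>] 0) :=
        tendsto_nhdsWithin_iff.2 ⟨by simpa using hpJ.norm,
          Eventually.of_forall fun m => norm_pos_iff.2 (hp0 _)⟩
      exact tendsto_inv_nhdsGT_zero.comp h2
    exact (tendsto_pow_atTop (by omega : M ≠ 0) |>.comp h1).const_mul_atTop hc
  have hgr : Tendsto (fun m => |(P m (Sum.inl 1)).re| / Real.log (2 + ‖P m (Sum.inl 1)‖))
      atTop atTop := by
    refine tendsto_abs_re_div_log_of_escape hLgtop (A := (‖Φ 0‖ + 1) / c) (fun m => ?_)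
      (fun m => ?_)
    · simp only [hPdef, Sum.elim_inl, Matrix.cons_val_one, Matrix.cons_val_zero, hLg]
      have := hre (J₀ + m)
      linarith
    · simp only [hPdef, Sum.elim_inl, Matrix.cons_val_one, Matrix.cons_val_zero, hLg]
      have := hnorm (J₀ + m)
      rw [show (‖Φ 0‖ + 1) / c * (c * ‖p (J₀ + m)‖⁻¹ ^ M) = (‖Φ 0‖ + 1) * ‖p (J₀ + m)‖⁻¹ ^ M by
        field_simp]
      exact this
  exact unprojectedDense_of_growth hS hdim 1 hPS hPΓ hgr

/-! ## Part B. The Fermat–Mantova–Masser example: `{x₀ⁿ + x₁ⁿ = 1, y₀ + y₁ = 1}`, every `n ≥ 2` -/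

/-- The relation `y₀ + y₁ − 1 ∈ ℂ[x₀, x₁, y₁][y₀]` and its degenerate part `y₀ − 1`: evaluations.
[folklore] -/
theorem eval_unitLine_relation (v : Fin 3 → ℂ) (y : ℂ) :
    ((Polynomial.X + Polynomial.C (MvPolynomial.X 2 - 1) :
      Polynomial (MvPolynomial (Fin 3) ℂ)).map (MvPolynomial.eval v)).eval y = y + (v 2 - 1) := by
  simp [Polynomial.map_add, Polynomial.map_X, Polynomial.map_C]

/-- The degenerate part `y₀ − 1 ∈ ℂ[x₀][x₁][y₀]`: evaluation. [folklore] -/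
theorem eval_unitLine_degenerate (x₀ x₁ y : ℂ) :
    ((Polynomial.X - Polynomial.C 1 : Polynomial ℂ[X][X]).map
      (Polynomial.eval₂RingHom (Polynomial.evalRingHom x₀) x₁)).eval y = y - 1 := by
  simp [Polynomial.map_sub, Polynomial.map_X]

/-- **THE FERMAT–MANTOVA–MASSER EXAMPLE, every exponent `n ≥ 2`.**  Every irreducible closed
`S ⊆ ℂ² × ℂ²` of dimension `≤ 2` containing all points `(x₀, x₁, y₀, e^{x₁})` with
`x₀ⁿ + x₁ⁿ = 1` and `y₀ + e^{x₁} = 1` — e.g. any such `S` containing the exponential points of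
Mantova–Masser's surface `{x₀ⁿ + x₁ⁿ = 1, y₀ + y₁ = 1}` near the place
`x₀ = 1/s`, `x₁ = e^{iπ/n}(1 − sⁿ)^{1/n}/s` — has Zariski-dense exponential points.  (The fibre
relation involves both `y₀` and `y₁`; the Fermat curve of even degree has no asymptote of
rational slope.) [cite: MantovaMasser2023, §1 Further remarks, p. 5 (the example (fermat),
`n = 9`; the question, open in general)] (new) -/
theorem unprojectedDense_fermat_unitLine {n : ℕ} (hn : 2 ≤ n) {S : Set (Fin 2 ⊕ Fin 2 → ℂ)}
    (hS : IsIrreducibleClosed ℂ S) (hdim : zariskiDim ℂ S ≤ (2 : ℕ))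
    (hsub : ∀ x₀ x₁ y : ℂ, x₀ ^ n + x₁ ^ n = 1 → y + Complex.exp x₁ = 1 →
      (Sum.elim ![x₀, x₁] ![y, Complex.exp x₁] : Fin 2 ⊕ Fin 2 → ℂ) ∈ S) :
    UnprojectedDense S := by
  classical
  have hn1 : 1 ≤ n := by omega
  have hn0 : n ≠ 0 := by omega
  -- the base curve `F = X^n + C(X^n − 1)` (rows: `x₁`-variable outer)
  set F : ℂ[X][X] := Polynomial.X ^ n + Polynomial.C (Polynomial.X ^ n - 1 : Polynomial ℂ) with hFdef
  have hFirr : Irreducible F := irreducible_fermat_row n hn1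
  have hFdeg : F.natDegree = n := by rw [hFdef, Polynomial.natDegree_X_pow_add_C]
  have hFeval : ∀ x₀ x₁ : ℂ, (F.map (Polynomial.evalRingHom x₀)).eval x₁ = x₁ ^ n + (x₀ ^ n - 1) := by
    intro x₀ x₁
    rw [hFdef]
    simp [Polynomial.map_add, Polynomial.map_pow, Polynomial.map_X, Polynomial.map_C]
  have hFnotunit : ∀ (a : ℂ[X][X]), IsUnit a → ¬ F ∣ a := by
    intro a ha hdvd
    exact hFirr.not_isUnit (isUnit_of_dvd_unit hdvd ha)
  -- the place `x₀ = s^{-1}`, `x₁ = ζ q(sⁿ) s^{-1}`, `ζ = exp(iπ/n)`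
  obtain ⟨q, d, hqan, -, hq0, -, hqn⟩ := fermat_branch_facts n hn1
  set ζ : ℂ := Complex.exp (Real.pi / n * I) with hζdef
  have hζn : ζ ^ n = -1 := by
    rw [hζdef, ← Complex.exp_nat_mul, show (n : ℂ) * (Real.pi / n * I) = Real.pi * I by
      field_simp, Complex.exp_pi_mul_I]
  set Φ : ℂ → ℂ := fun s => ζ * q (s ^ n) with hΦdef
  have hsn : AnalyticAt ℂ (fun s : ℂ => s ^ n) 0 := analyticAt_id.pow n
  have h0n : (0 : ℂ) ^ n = 0 := zero_pow hn0
  have hΦan : AnalyticAt ℂ Φ 0 := analyticAt_const.mul (hqan.comp_of_eq hsn h0n)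
  have hΦ0 : Φ 0 = ζ := by simp [hΦdef, h0n, hq0]
  have hqn' : ∀ᶠ s in 𝓝 (0 : ℂ), q (s ^ n) ^ n = 1 - s ^ n := by
    have h := hsn.continuousAt.tendsto
    rw [h0n] at h
    exact h.eventually hqn
  have hplace : ∀ᶠ s in 𝓝[≠] (0 : ℂ),
      (F.map (Polynomial.evalRingHom (s ^ 1)⁻¹)).eval (Φ s * (s ^ 1)⁻¹) = 0 := by
    filter_upwards [self_mem_nhdsWithin, nhdsWithin_le_nhds hqn'] with s hs hqs
    have hs' : (s : ℂ) ≠ 0 := hs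
    rw [hFeval, hΦdef]
    simp only [pow_one, mul_pow, inv_pow, hζn, hqs]
    field_simp
    ring
  -- the direction `z = 2πi`: `Re(ζ · 2πi) = -2π sin(π/n) < 0`
  have hz : (2 * Real.pi * I : ℂ) ^ 1 = 2 * Real.pi * I := pow_one _
  have hdir : (Φ 0 * (2 * Real.pi * I) ^ 1).re < 0 := by
    have hsin : 0 < Real.sin (Real.pi / n) := by
      apply Real.sin_pos_of_pos_of_lt_pi
      · positivity
      · have : (1 : ℝ) < n := by exact_mod_cast hn
        rw [div_lt_iff₀ (by positivity)]
        nlinarith [Real.pi_pos]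
    have him : ζ.im = Real.sin (Real.pi / n) := by
      rw [hζdef, show (Real.pi / n * I : ℂ) = ((Real.pi / n : ℝ) : ℂ) * I by push_cast; ring,
        Complex.exp_ofReal_mul_I_im]
    have hbre : (2 * Real.pi * I : ℂ).re = 0 := by simp
    have hbim : (2 * Real.pi * I : ℂ).im = 2 * Real.pi := by simp
    rw [hΦ0, pow_one, Complex.mul_re, hbre, hbim, him, mul_zero, zero_sub]
    nlinarith [hsin, Real.pi_pos]
  -- the relation and its degenerate part
  set G : Polynomial (MvPolynomial (Fin 3) ℂ) := Polynomial.X + Polynomial.C (MvPolynomial.X 2 - 1)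
    with hGdef
  set G₀ : Polynomial ℂ[X][X] := Polynomial.X - Polynomial.C 1 with hG₀def
  have hG₀deg : G₀.natDegree = 1 := by rw [hG₀def, Polynomial.natDegree_X_sub_C]
  have hG₀ : ∀ x₀ x₁ y : ℂ,
      (G₀.map (Polynomial.eval₂RingHom (Polynomial.evalRingHom x₀) x₁)).eval y =
        (G.map (MvPolynomial.eval ![x₀, x₁, 0])).eval y := by
    intro x₀ x₁ y
    rw [hG₀def, hGdef, eval_unitLine_degenerate, eval_unitLine_relation]
    have h2 : (![x₀, x₁, (0 : ℂ)] : Fin 3 → ℂ) 2 = 0 := rfl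
    rw [h2]
    ring
  have htop : ¬ F ∣ G₀.leadingCoeff := by
    rw [hG₀def, Polynomial.leadingCoeff_X_sub_C]
    exact hFnotunit _ isUnit_one
  have hbot : ¬ F ∣ G₀.coeff 0 := by
    rw [hG₀def, Polynomial.coeff_sub, Polynomial.coeff_X_zero, Polynomial.coeff_C_zero, zero_sub]
    exact hFnotunit _ ((isUnit_one (M := ℂ[X][X])).neg)
  have hdisc : ¬ F ∣ Polynomial.resultant G₀ (derivative G₀) G₀.natDegree (G₀.natDegree - 1) := by
    rw [hG₀deg, Nat.sub_self, Polynomial.resultant_zero_right_deg, hG₀def, Polynomial.derivative_sub,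
      Polynomial.derivative_X, Polynomial.derivative_C, sub_zero, Polynomial.coeff_one_zero, one_pow]
    exact hFnotunit _ isUnit_one
  -- apply the S-form theorem
  refine unprojectedDense_degenerateDirection F hFirr (by rw [hFdeg]; exact hn1) le_rfl le_rfl hΦan
    hplace hz hdir G G₀ hG₀ (by rw [hG₀deg]) htop hbot hdisc hS hdim ?_
  filter_upwards [hplace] with s hs y _ hy
  rw [hGdef, eval_unitLine_relation] at hy
  have h2 : (![(s ^ 1)⁻¹, Φ s * (s ^ 1)⁻¹, Complex.exp (Φ s * (s ^ 1)⁻¹)] : Fin 3 → ℂ) 2 =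
      Complex.exp (Φ s * (s ^ 1)⁻¹) := rfl
  rw [h2] at hy
  refine hsub _ _ y ?_ ?_
  · rw [hFeval] at hs
    linear_combination hs
  · linear_combination hy

end DegenerateDirectionDensity

end Summit.Schanuel.Schanuel.Theorems

end
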